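import Summits.BirchSwinnertonDyer.BirchSwinnertonDyer.Theorems.UniversalToricDescentTwoSidedMuTransferHoward
import HarnessLib

/-!
# Route UniversalToricDescent — the two-sided link in `μ`-currency, PACKAGED FORM for skeletons on tree objects
# (`U := Λ`, the arithmetic delivered as one inequality), any prime `p`

Lead prover bsd-wall-utd-p1 g21 (`--supports stmt-BirchSwinnertonDyer-24737`, crux `TwinAlgMuZeroAtThree` R2);
third file of the series `…TwoSidedMuTransfer` (p730564) / `…TwoSidedMuTransferHoward` (p730950).

A skeleton for 24737 on TREE objects (`LambdaAdicSelmerData D`, `SelmerDualData X`, `HeegnerFamily F`,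
`XAc … 𝔭′ ∅ γ`) has no tree carrier for `X_{∅,Gr}`, `X_{Gr,0}`, `H¹_Gr(K_𝔭, 𝐓^ac)`; the natural shape of
its PRINT-port stub is therefore: after identifying `U_𝔭 ≅ Λ`, a Λ-linear `loc : 𝔖 → Λ` and a class `κ∞ ∈ ℋ_∞`
with «`loc κ∞ ≠ 0 ⟹ X_{∅,0}` torsion and `μ(X_{∅,0}) ≤ μ(X_tors) + 2·μ(Λ/loc 𝔖)`» — exactly the conclusion
of the landed `isTorsion_and_muInvariant_le_twoSided` (Castella 2017 App. A (A.5)–(A.7)). This file closes the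
remaining algebra between that shape, Howard's K2 (`Ch(X_tors) ∣ Ch(𝔖/ℋ)²`) and K1 (`loc κ∞ ∉ (p)`):

* §1 `isTorsion_quotient_span_of_finrank_eq_one` — `𝔖` finitely generated torsion-free of rank one, `κ ≠ 0`
  ⟹ `𝔖/Λκ` torsion (any two elements are linearly dependent).
* §2 `isTorsion_and_muInvariant_eq_zero_quotient_of_not_mem_augIdealP` — `a ∉ (p)` ⟹ `Λ/Λa` torsion with `μ = 0`.
* §3 **`isTorsion_and_exists_generator_of_package`** — package inequality + K2 (char-ideal currency, any
  `ℋ ∋ κ∞`) + K1 ⟹ `X_{∅,0}` torsion and `Ch_Λ(X_{∅,0})·R₀⟦T⟧ = (g)` with a norm-one coefficient of `g`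
  (the conclusion shape of `TwinAlgMuZeroAtThree`). With it the composition of a 24737 skeleton is one `exact`.

THEOREMS ONLY; no `Theses` import; std axioms. BSD is not advanced by this file; stmt-24737 stays open.
References: [Castella2017HeegnerBeilinsonFlach] App. A; [Howard2004HeegnerKolyvagin] Thm. B; [Washington1997] §13.2.
-/

noncomputable section
open scoped Classical

-- `…BirchSwinnertonDyer.BirchSwinnertonDyer.Theorems…` is the problem's mandated namespace (D-0017).
set_option linter.dupNamespace false
set_option autoImplicit false

namespace Summit.BirchSwinnertonDyer.BirchSwinnertonDyer.Theorems.UniversalToricDescentTwoSidedMuTransfer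

open Literature.NumberTheory.EllipticCurves Literature.NumberTheory.EllipticCurves.IwasawaAlgebra
  Literature.NumberTheory.EllipticCurves.Module
  Summit.BirchSwinnertonDyer.BirchSwinnertonDyer.Theorems.UniversalToricDescentAcDualMuZero

variable {p : ℕ} [Fact p.Prime]

/-! ### §1 Rank one: `𝔖/Λκ` is torsion for `κ ≠ 0` -/

/-- **In a finitely generated torsion-free `Λ`-module of rank one, the quotient by a non-zero element is
torsion**: any two elements `κ, m` are linearly dependent (`card ≤ finrank`), `s•κ + t•m = 0` with `t ≠ 0`
(else `s•κ = 0`, `s ≠ 0`, contradicting torsion-freeness), so `t` kills `m̄`. (Castella App. A uses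
«`Sel(K, 𝐓^ac)` has `Λ^ac`-rank 1», Howard Thm. B's first conclusion.) [cite: Howard2004HeegnerKolyvagin, Thm. B] -/
theorem isTorsion_quotient_span_of_finrank_eq_one {S : Type*} [AddCommGroup S] [Module (IwasawaAlgebra p) S]
    [Module.Finite (IwasawaAlgebra p) S] [NoZeroSMulDivisors (IwasawaAlgebra p) S]
    (h1 : Module.finrank (IwasawaAlgebra p) S = 1) {κ : S} (hκ : κ ≠ 0) :
    Module.IsTorsion (IwasawaAlgebra p) (S ⧸ Submodule.span (IwasawaAlgebra p) {κ}) := by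
  intro x
  induction x using Submodule.Quotient.induction_on with
  | H m =>
    have hdep : ¬ LinearIndependent (IwasawaAlgebra p) ![κ, m] := by
      intro hli
      have := hli.fintype_card_le_finrank
      rw [Fintype.card_fin, h1] at this
      omega
    rw [LinearIndependent.pair_iff] at hdep
    push Not at hdep
    obtain ⟨s, t, hst, hne⟩ := hdep
    have ht : t ≠ 0 := by
      intro ht
      rw [ht, zero_smul, add_zero] at hst
      rcases smul_eq_zero.mp hst with hs | hκ0
      · exact hne hs ht
      · exact hκ hκ0
    refine ⟨⟨t, mem_nonZeroDivisors_of_ne_zero ht⟩, ?_⟩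
    rw [Submonoid.mk_smul, ← Submodule.Quotient.mk_smul, Submodule.Quotient.mk_eq_zero,
      Submodule.mem_span_singleton]
    exact ⟨-s, by rw [neg_smul]; exact neg_eq_of_add_eq_zero_right hst⟩

/-! ### §2 `a ∉ (p)` ⟹ `Λ/Λa` torsion with `μ = 0` -/

/-- `a ∉ (p) ⊂ Λ` ⟹ `a` is not `p` times an element of `Λ` (the form of K1 consumed by
`isTorsion_and_muInvariant_eq_zero_of_not_mem_smul` with `U = Λ`). [folklore] -/
theorem not_exists_eq_smul_of_not_mem_augIdealP {a : IwasawaAlgebra p} (ha : a ∉ augIdealP p) :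
    ¬ ∃ v : IwasawaAlgebra p, a = (p : IwasawaAlgebra p) • v := by
  rintro ⟨v, hv⟩
  apply ha
  rw [augIdealP, Ideal.mem_span_singleton]
  exact ⟨v, by rw [hv, smul_eq_mul, ← map_natCast (PowerSeries.C (R := ℤ_[p])) p]⟩

/-- **`a ∉ (p)` ⟹ `Λ/Λa` is torsion with `μ(Λ/Λa) = 0`.** [cite: Washington1997, §13.2] -/
theorem isTorsion_and_muInvariant_eq_zero_quotient_of_not_mem_augIdealP {a : IwasawaAlgebra p}
    (ha : a ∉ augIdealP p) :
    Module.IsTorsion (IwasawaAlgebra p) (IwasawaAlgebra p ⧸ Submodule.span (IwasawaAlgebra p) {a}) ∧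
      muInvariant p (IwasawaAlgebra p ⧸ Submodule.span (IwasawaAlgebra p) {a}) = 0 :=
  isTorsion_and_muInvariant_eq_zero_of_not_mem_smul (LinearEquiv.refl (IwasawaAlgebra p) _) a
    (not_exists_eq_smul_of_not_mem_augIdealP ha)

/-! ### §3 The packaged assembly -/

/-- **Package + K2 + K1 ⟹ the conclusion of `TwinAlgMuZeroAtThree` at `X₀ = X_{∅,0}`.** Data, all on the
objects a tree-level skeleton quantifies over: `𝔖` finitely generated torsion-free of rank one (Howard Thm. B
(first part)), the class `κ ∈ ℋ ≤ 𝔖` (`ℋ` = Heegner module), `loc : 𝔖 →ₗ Λ` (`loc_𝔭` after `U_𝔭 ≅ Λ`), the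
finitely generated `X₀ = X_{∅,0}` and `X = X(E′/K_∞)`;
PACKAGE (print-port arithmetic: Castella App. A (A.5)–(A.7), via `isTorsion_and_muInvariant_le_twoSided`)
`loc κ ≠ 0 → X₀ torsion ∧ μ(X₀) ≤ μ(X_tors) + 2·μ(Λ/loc 𝔖)`; K2 `Ch(X_tors) ∣ Ch(𝔖/ℋ)²`; K1 `loc κ ∉ (p)`.
Conclusion: `X₀` is torsion and `Ch_Λ(X₀)·R₀⟦T⟧ = (g)` with a norm-one coefficient of `g`. Proof:
`μ(X₀) ≤ μ(X_tors) + 2μ(Λ/loc𝔖) ≤ 2μ(𝔖/ℋ) + 2μ(Λ/loc𝔖) ≤ 2μ(𝔖/Λκ) + 2μ(Λ/loc𝔖) = 2μ(Λ/Λ·loc κ) = 0`.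
[cite: Castella2017HeegnerBeilinsonFlach, App. A, Lemmas A.2–A.4, Thm. A.5 (arXiv:1509.02761 pp. 18–20)]
[cite: Howard2004HeegnerKolyvagin, Thm. B] [cite: GreenbergVatsal2000, p. 2, (1)–(2)] -/
theorem isTorsion_and_exists_generator_of_package {S X X₀ : Type*}
    [AddCommGroup S] [Module (IwasawaAlgebra p) S] [Module.Finite (IwasawaAlgebra p) S]
    [NoZeroSMulDivisors (IwasawaAlgebra p) S]
    [AddCommGroup X] [Module (IwasawaAlgebra p) X] [Module.Finite (IwasawaAlgebra p) X]
    [AddCommGroup X₀] [Module (IwasawaAlgebra p) X₀] [Module.Finite (IwasawaAlgebra p) X₀]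
    (h1 : Module.finrank (IwasawaAlgebra p) S = 1) (κ : S) (H : Submodule (IwasawaAlgebra p) S) (hκH : κ ∈ H)
    (loc : S →ₗ[IwasawaAlgebra p] IwasawaAlgebra p)
    (hpkg : loc κ ≠ 0 → Module.IsTorsion (IwasawaAlgebra p) X₀ ∧
      muInvariant p X₀ ≤ muInvariant p (Submodule.torsion (IwasawaAlgebra p) X) +
        2 * muInvariant p (IwasawaAlgebra p ⧸ LinearMap.range loc))
    (hHoward : Module.charIdeal (IwasawaAlgebra p) (Submodule.torsion (IwasawaAlgebra p) X) ∣
      Module.charIdeal (IwasawaAlgebra p) (S ⧸ H) ^ 2)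
    (hβ : loc κ ∉ augIdealP p) :
    Module.IsTorsion (IwasawaAlgebra p) X₀ ∧
      ∃ g : UnrSeries p,
        (Module.charIdeal (IwasawaAlgebra p) X₀).map
            (PowerSeries.map (Summit.BirchSwinnertonDyer.Rank1Residual.X11b.Halves.toUnr p)) =
          Ideal.span {g} ∧
          ∃ i : ℕ, ‖((PowerSeries.coeff i g : unrIntegers p) : ℂ_[p])‖ = 1 := by
  have hloc0 : loc κ ≠ 0 := fun h => hβ (h ▸ Submodule.zero_mem _)
  have hκ0 : κ ≠ 0 := fun h => hloc0 (by rw [h, map_zero])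
  obtain ⟨hX₀, hle⟩ := hpkg hloc0
  -- `𝔖/Λκ` torsion, `loc` injective
  have hSκ := isTorsion_quotient_span_of_finrank_eq_one h1 hκ0
  have hinj : Function.Injective loc := injective_of_isTorsion_quotient loc κ hSκ hloc0
  -- Howard in μ-currency
  haveI : IsNoetherian (IwasawaAlgebra p) X := isNoetherian_of_isNoetherianRing_of_finite _ _
  haveI : Module.Finite (IwasawaAlgebra p) (Submodule.torsion (IwasawaAlgebra p) X) :=
    Module.Finite.iff_fg.mpr (IsNoetherian.noetherian _)
  have hleH : Submodule.span (IwasawaAlgebra p) {κ} ≤ H.comap LinearMap.id := by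
    rw [Submodule.comap_id, Submodule.span_singleton_le_iff_mem]; exact hκH
  have hSH : Module.IsTorsion (IwasawaAlgebra p) (S ⧸ H) :=
    Literature.NumberTheory.EllipticCurves.isTorsion_of_surjective (Submodule.mapQ _ _ LinearMap.id hleH)
      (fun y => by
        induction y using Submodule.Quotient.induction_on with
        | H s => exact ⟨Submodule.Quotient.mk s, by rw [Submodule.mapQ_apply, LinearMap.id_apply]⟩) hSκ
  have hHow1 := muInvariant_le_mul_of_charIdeal_dvd_pow
    (Submodule.torsion_isTorsion (R := IwasawaAlgebra p) (M := X)) hSH 2 hHoward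
  have hHow2 := muInvariant_quotient_le_of_mem H hκH hSκ
  -- K1-currency and (A.4)
  obtain ⟨hTΛ, hμ0⟩ := isTorsion_and_muInvariant_eq_zero_quotient_of_not_mem_augIdealP hβ
  have hA4 := muInvariant_quotient_span_eq_add loc hinj κ hTΛ
  have hμ : muInvariant p X₀ = 0 := by omega
  exact ⟨hX₀, exists_map_charIdeal_eq_span_of_muInvariant_eq_zero X₀ hX₀ hμ⟩

end Summit.BirchSwinnertonDyer.BirchSwinnertonDyer.Theorems.UniversalToricDescentTwoSidedMuTransfer

end
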